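import Literature.NumberTheory.Transcendental.PhilipponZeroEstimateLeibniz
import Literature.NumberTheory.Transcendental.BakerQuantArith
import HarnessLib

/-!
# The linear subgroup theorem on `𝔾ₐ × 𝔾ₘ^N` (Waldschmidt 1988, Thm 4.1), III: arithmetic of the jets

Topic `Literature/NumberTheory/Transcendental`; third file of the direct proof of
[Waldschmidt1988, Thm 4.1] for `G = 𝔾ₐ × 𝔾ₘ^N` (plan in `LinearSubgroupGaGmAuxiliary.lean`).
Part II bounds the values `(D_{u₀} ⋯ D_{u_{j-1}} P)(exp_G y)` of words of invariant derivations
(letters in `W`, points `y` in the box `Y(S')` of the group `Y = ∑ ℤyᵢ`) by the size of the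
auxiliary function. Here we do their ARITHMETIC, in the generality: `P = ∑_λ a_λ X^{s_λ}` with
integer coefficients, letters `uₗ = ψ(εₗ)` and points `exp_G(∑ hᵢyᵢ) = ψ(z(h), x(h))`,
`z(h) = ∑ hᵢ aᵢ`, `x(h)_j = ∏ᵢ θᵢⱼ^{hᵢ}`, all images under an embedding `ψ : K → ℂ` of elements of a
number field `K`. Then (Liouville's argument, [Waldschmidt1988] p. 389 via [Waldschmidt1981] §4):

* `exists_coeffs_wordDeriv_monomial` — for a word `ε` of length `j` with letters in `K × K^N` and an
  exponent `s`, there are `c₀, …, c_{s₀} ∈ K` with, for EVERY embedding `ψ`,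
  `D_{ψε₀} ⋯ D_{ψε_{j-1}} (X^s) = ∑ᵢ ψ(cᵢ) X^{s[0 ↦ i]}` (the torus exponents are untouched, the
  additive exponent only drops: `GaGm.invDeriv_monomial`), `b^j cᵢ ∈ 𝓞_K` when `b εₗ` is integral,
  and `|ψ(cᵢ)| ≤ ((s₀ + |s'|) E)^j` when the coordinates of the `ψ(εₗ)` are `≤ E`;
* `exists_wordValue` — consequently the value of a word at the point `h` of the box is `ψ(v)` for a
  `v ∈ K` INDEPENDENT of `ψ`, with `b^{j + D₀ + M S' D₁} v ∈ 𝓞_K` and all conjugates bounded;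
* `wordValue_eq_zero_of_small` — so, by the Liouville inequality
  (`Baker1975.Ch3.liouville_lower_bound`), a value that is too small is ZERO.

Everything here is PROVED; no definitions, no named facts.

## References

* [Waldschmidt1988] M. Waldschmidt, *On the transcendence methods of Gel'fond and Schneider in
  several variables*, New Advances in Transcendence Theory (A. Baker ed.), CUP 1988, 375–398, §§6–7.
* [Waldschmidt1981] M. Waldschmidt, *Transcendance et exponentielles en plusieurs variables*,
  Invent. Math. 63 (1981) 97–127, §4 (Liouville step of Corollaire 4.2).
-/

noncomputable section

open MvPolynomial Complex Finset

namespace Literature.NumberTheory.Transcendental.LinearSubgroupGaGm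

open GaGm

variable {N : ℕ}

/-! ### Linearity of words -/

/-- Words are `ℂ`-linear in the polynomial. [folklore] -/
theorem wordDeriv_smul {k : ℕ} (u : Fin k → ℂ × (Fin N → ℂ)) (c : ℂ)
    (Q : MvPolynomial (Fin (N + 1)) ℂ) : wordDeriv u (c • Q) = c • wordDeriv u Q := by
  induction k generalizing Q with
  | zero => rfl
  | succ k ih => rw [wordDeriv_succ, wordDeriv_succ, Derivation.map_smul, ih]

/-- Words are additive over finite sums. [folklore] -/
theorem wordDeriv_sum {k : ℕ} (u : Fin k → ℂ × (Fin N → ℂ)) {ι : Type*} (s : Finset ι)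
    (Q : ι → MvPolynomial (Fin (N + 1)) ℂ) :
    wordDeriv u (∑ i ∈ s, Q i) = ∑ i ∈ s, wordDeriv u (Q i) := by
  classical
  induction s using Finset.induction_on with
  | empty => simp
  | insert a s ha ih => rw [Finset.sum_insert ha, Finset.sum_insert ha, wordDeriv_add, ih]

/-! ### Exponents: replacing the additive exponent -/

/-- The exponent `s[0 ↦ i]`. [folklore] -/
theorem update_zero_apply_zero (s : Fin (N + 1) →₀ ℕ) (i : ℕ) : (s.update 0 i) 0 = i := by
  classical
  rw [Finsupp.coe_update, Function.update_self]

/-- `s[0 ↦ i]` agrees with `s` on the torus indices. [folklore] -/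
theorem update_zero_apply_succ (s : Fin (N + 1) →₀ ℕ) (i : ℕ) (j : Fin N) :
    (s.update 0 i) j.succ = s j.succ := by
  classical
  rw [Finsupp.coe_update, Function.update_of_ne (Fin.succ_ne_zero j)]

/-- Lowering the additive exponent: `s[0 ↦ i] − e₀ = s[0 ↦ i − 1]`. [folklore] -/
theorem update_zero_sub_single (s : Fin (N + 1) →₀ ℕ) (i : ℕ) :
    s.update 0 i - Finsupp.single 0 1 = s.update 0 (i - 1) := by
  classical
  ext a
  rw [Finsupp.tsub_apply, Finsupp.single_apply]
  refine Fin.cases ?_ (fun j => ?_) a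
  · rw [update_zero_apply_zero, update_zero_apply_zero, if_pos rfl]
  · rw [update_zero_apply_succ, update_zero_apply_succ, if_neg (Fin.succ_ne_zero j).symm, Nat.sub_zero]

/-- The torus weight does not see the additive exponent. [folklore] -/
theorem torusWeight_update_zero (s : Fin (N + 1) →₀ ℕ) (i : ℕ) (w : ℂ × (Fin N → ℂ)) :
    torusWeight (s.update 0 i) w = torusWeight s w := by
  unfold torusWeight
  refine Finset.sum_congr rfl fun h _ => ?_
  rw [update_zero_apply_succ]

/-- `s[0 ↦ s₀] = s`. [folklore] -/
theorem update_zero_self (s : Fin (N + 1) →₀ ℕ) : s.update 0 (s 0) = s := Finsupp.update_self _ _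

/-! ### Words on monomials: the coefficients and their arithmetic -/

section Coeffs

variable {K : Type*} [Field K]

/-- The complex letter attached to `ε ∈ K × K^N` and an embedding `ψ`. (Written out, no definition:
`(ψ ε.1, ψ ∘ ε.2)`.) The torus weight of `ψ(ε)` is `ψ` of the torus weight computed in `K`.
[folklore] -/
theorem torusWeight_map (ψ : K →+* ℂ) (ε : K × (Fin N → K)) (s : Fin (N + 1) →₀ ℕ) :
    torusWeight s ((ψ ε.1, fun j => ψ (ε.2 j)) : ℂ × (Fin N → ℂ)) =
      ψ (∑ h : Fin N, ε.2 h * (s h.succ : K)) := by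
  simp [torusWeight, map_sum]

/-- **Words on monomials.** For a word `ε₀, …, ε_{j-1}` with letters in `K × K^N` and an exponent
`s`, there are `c₀, c₁, … ∈ K`, `cᵢ = 0` for `i > s₀`, such that for every embedding `ψ : K → ℂ`
`D_{ψε₀} ⋯ D_{ψε_{j-1}} (X^s) = ∑_{i ≤ s₀} ψ(cᵢ) X^{s[0 ↦ i]}`; moreover `b^j cᵢ` is an algebraic
integer as soon as all `b·(εₗ)` are, and `|ψ(cᵢ)| ≤ ((s₀ + ∑ₕ s_{h+1}) E)^j` as soon as all the
coordinates of the `ψ(εₗ)` have modulus `≤ E`. [folklore] -/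
theorem exists_coeffs_wordDeriv_monomial (s : Fin (N + 1) →₀ ℕ) :
    ∀ {j : ℕ} (ε : Fin j → K × (Fin N → K)),
      ∃ c : ℕ → K, (∀ i, s 0 < i → c i = 0) ∧
        (∀ ψ : K →+* ℂ,
          wordDeriv (fun l => ((ψ (ε l).1, fun h => ψ ((ε l).2 h)) : ℂ × (Fin N → ℂ)))
              (monomial s (1 : ℂ)) =
            ∑ i ∈ range (s 0 + 1), monomial (s.update 0 i) (ψ (c i))) ∧
        (∀ b : ℕ, (∀ l, IsIntegral ℤ ((b : K) * (ε l).1) ∧ ∀ h, IsIntegral ℤ ((b : K) * (ε l).2 h)) →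
          ∀ i, IsIntegral ℤ ((b : K) ^ j * c i)) ∧
        (∀ (ψ : K →+* ℂ) (E : ℝ), (∀ l, ‖ψ (ε l).1‖ ≤ E ∧ ∀ h, ‖ψ ((ε l).2 h)‖ ≤ E) →
          ∀ i, ‖ψ (c i)‖ ≤ (((s 0 : ℝ) + ∑ h : Fin N, (s h.succ : ℝ)) * E) ^ j) := by
  intro j
  induction j with
  | zero =>
    intro ε
    refine ⟨fun i => if i = s 0 then 1 else 0, fun i hi => if_neg (Nat.ne_of_gt hi), fun ψ => ?_,
      fun b _ i => ?_, fun ψ E _ i => ?_⟩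
    · rw [wordDeriv_zero, Finset.sum_eq_single (s 0)]
      · simp only [if_true, map_one, update_zero_self]
      · intro i _ hi
        simp only [if_neg hi, map_zero, map_zero]
      · intro h
        exact absurd (Finset.mem_range.mpr (Nat.lt_succ_self _)) h
    · dsimp only
      rw [pow_zero, one_mul]
      split_ifs
      · exact isIntegral_one
      · exact isIntegral_zero
    · dsimp only
      rw [pow_zero]
      split_ifs
      · rw [map_one, norm_one]
      · rw [map_zero, norm_zero]; exact zero_le_one
  | succ j ih =>
    intro ε
    obtain ⟨c, hc0, hcP, hcI, hcB⟩ := ih (Fin.tail ε)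
    -- the new coefficients: `c'ᵢ = ε₀.1 (i+1) c_{i+1} + (torus weight of ε₀) cᵢ`
    set e : K × (Fin N → K) := ε 0 with he
    set tw : K := ∑ h : Fin N, e.2 h * (s h.succ : K) with htw
    refine ⟨fun i => e.1 * ((i + 1 : ℕ) : K) * c (i + 1) + tw * c i, fun i hi => ?_, fun ψ => ?_,
      fun b hb i => ?_, fun ψ E hE i => ?_⟩
    · -- support
      dsimp only
      rw [hc0 i hi, hc0 (i + 1) (Nat.lt_succ_of_lt hi), mul_zero, mul_zero, add_zero]
    · -- the polynomial identity
      have hw : (fun l : Fin (j + 1) => ((ψ (ε l).1, fun h => ψ ((ε l).2 h)) : ℂ × (Fin N → ℂ))) =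
          Fin.cons ((ψ e.1, fun h => ψ (e.2 h)) : ℂ × (Fin N → ℂ))
            (fun l : Fin j => ((ψ (Fin.tail ε l).1, fun h => ψ ((Fin.tail ε l).2 h)) :
              ℂ × (Fin N → ℂ))) := by
        funext l
        refine Fin.cases ?_ (fun l' => ?_) l
        · simp only [Fin.cons_zero, he]
        · simp only [Fin.cons_succ, Fin.tail]
      dsimp only
      rw [hw, wordDeriv_cons, hcP ψ, map_sum]
      simp only [invDeriv_monomial, torusWeight_update_zero]
      simp only [torusWeight_map, update_zero_sub_single, update_zero_apply_zero, smul_monomial,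
        smul_eq_mul, Finset.sum_add_distrib]
      -- reindex the first sum (`i ↦ i - 1`; the term `i = 0` vanishes, the term `i = s₀ + 1` too)
      have h1 : ∑ i ∈ range (s 0 + 1), monomial (s.update 0 (i - 1)) (ψ e.1 * ((i : ℕ) : ℂ) * ψ (c i)) =
          ∑ i ∈ range (s 0 + 1),
            monomial (s.update 0 i) (ψ (e.1 * ((i + 1 : ℕ) : K) * c (i + 1))) := by
        rw [Finset.sum_range_succ' (fun i =>
          monomial (s.update 0 (i - 1)) (ψ e.1 * ((i : ℕ) : ℂ) * ψ (c i)))]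
        simp only [Nat.cast_zero, mul_zero, zero_mul, monomial_zero, add_zero, Nat.add_sub_cancel]
        rw [Finset.sum_range_succ, hc0 (s 0 + 1) (Nat.lt_succ_self _)]
        simp only [map_mul, map_natCast, map_zero, mul_zero, add_zero]
      rw [h1, ← Finset.sum_add_distrib]
      refine Finset.sum_congr rfl fun i _ => ?_
      rw [← map_add (monomial (s.update 0 i))]
      congr 1
      rw [map_add ψ, map_mul ψ tw, ← htw, mul_comm (ψ tw)]
    · -- integrality
      dsimp only
      have hb0 : IsIntegral ℤ ((b : K) * e.1) := (hb 0).1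
      have hbtw : IsIntegral ℤ ((b : K) * tw) := by
        rw [htw, Finset.mul_sum]
        refine IsIntegral.sum _ fun h _ => ?_
        rw [← mul_assoc]
        exact ((hb 0).2 h).mul (isIntegral_natCast _)
      have hI := hcI b (fun l => hb l.succ)
      have hsplit : (b : K) ^ (j + 1) * (e.1 * ((i + 1 : ℕ) : K) * c (i + 1) + tw * c i) =
          ((b : K) * e.1) * ((i + 1 : ℕ) : K) * ((b : K) ^ j * c (i + 1)) +
            ((b : K) * tw) * ((b : K) ^ j * c i) := by ring
      rw [hsplit]
      exact ((hb0.mul (isIntegral_natCast _)).mul (hI _)).add (hbtw.mul (hI _))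
    · -- bounds
      dsimp only
      have hB := hcB ψ E (fun l => hE l.succ)
      have hE0 : 0 ≤ E := (norm_nonneg _).trans (hE 0).1
      set X : ℝ := ((s 0 : ℝ) + ∑ h : Fin N, (s h.succ : ℝ)) * E with hX
      have hX0 : 0 ≤ X := by positivity
      have hs0 : ∀ i, ‖ψ (c i)‖ * ((i : ℕ) : ℝ) ≤ X ^ j * (s 0 : ℝ) := by
        intro i
        by_cases hi : s 0 < i
        · rw [hc0 i hi, map_zero, norm_zero, zero_mul]; positivity
        · push Not at hi
          exact mul_le_mul (hB i) (by exact_mod_cast hi) (Nat.cast_nonneg _) (by positivity)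
      have htwle : ‖ψ tw‖ ≤ E * ∑ h : Fin N, (s h.succ : ℝ) := by
        rw [htw, map_sum, Finset.mul_sum]
        refine (norm_sum_le _ _).trans (Finset.sum_le_sum fun h _ => ?_)
        rw [map_mul, map_natCast, norm_mul, Complex.norm_natCast]
        exact mul_le_mul_of_nonneg_right ((hE 0).2 h) (Nat.cast_nonneg _)
      calc ‖ψ (e.1 * ((i + 1 : ℕ) : K) * c (i + 1) + tw * c i)‖
          ≤ ‖ψ (e.1 * ((i + 1 : ℕ) : K) * c (i + 1))‖ + ‖ψ (tw * c i)‖ := by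
            rw [map_add]; exact norm_add_le _ _
        _ = ‖ψ e.1‖ * (‖ψ (c (i + 1))‖ * ((i + 1 : ℕ) : ℝ)) + ‖ψ tw‖ * ‖ψ (c i)‖ := by
            rw [map_mul, map_mul, map_natCast, norm_mul, norm_mul, Complex.norm_natCast, map_mul,
              norm_mul]; ring
        _ ≤ E * (X ^ j * (s 0 : ℝ)) + (E * ∑ h : Fin N, (s h.succ : ℝ)) * X ^ j :=
            add_le_add (mul_le_mul (hE 0).1 (hs0 (i + 1)) (by positivity) hE0)
              (mul_le_mul htwle (hB i) (norm_nonneg _) (by positivity))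
        _ = X ^ (j + 1) := by rw [hX]; ring

end Coeffs

/-! ### Integrality bookkeeping -/

section Integral

variable {K : Type*} [Field K]

/-- Padding the power of the denominator. [folklore] -/
theorem isIntegral_pow_mul_of_le {b : ℕ} {x : K} {e e' : ℕ} (h : IsIntegral ℤ ((b : K) ^ e * x))
    (he : e ≤ e') : IsIntegral ℤ ((b : K) ^ e' * x) := by
  obtain ⟨d, rfl⟩ := Nat.exists_eq_add_of_le he
  have : (b : K) ^ (e + d) * x = (b : K) ^ d * ((b : K) ^ e * x) := by ring
  rw [this]
  exact ((isIntegral_natCast _).pow _).mul h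

/-- Powers: `(b x)ⁿ = bⁿ xⁿ` is integral. [folklore] -/
theorem isIntegral_pow_mul_pow {b : ℕ} {x : K} (h : IsIntegral ℤ ((b : K) * x)) (n : ℕ) :
    IsIntegral ℤ ((b : K) ^ n * x ^ n) := by
  rw [← mul_pow]; exact h.pow n

/-- Products: if `b^{e_k} x_k` is integral for all `k ∈ s` then so is `b^{∑ e_k} ∏ x_k`. [folklore] -/
theorem isIntegral_pow_sum_mul_prod {α : Type*} (s : Finset α) {b : ℕ} (e : α → ℕ) (x : α → K)
    (h : ∀ k ∈ s, IsIntegral ℤ ((b : K) ^ e k * x k)) :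
    IsIntegral ℤ ((b : K) ^ (∑ k ∈ s, e k) * ∏ k ∈ s, x k) := by
  rw [← Finset.prod_pow_eq_pow_sum, ← Finset.prod_mul_distrib]
  exact IsIntegral.prod _ h

end Integral

/-! ### The points of the box and the values of words -/

section Values

variable {K : Type*} [Field K] {ι : Type*} [Fintype ι]

/-- **Monomials at the points of the box.** At a point of `𝔾ₐ × 𝔾ₘ^N(ℂ)` with coordinates
`(ψ(z), ψ(x₁), …, ψ(x_N))` the monomial `c X^{s'}` takes the value `c · ψ(z^{s'₀} ∏ⱼ xⱼ^{s'_{j+1}})`.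
[folklore] -/
theorem evalAt_monomial_of_coord (ψ : K →+* ℂ) (g : GaGm N) (z : K) (x : Fin N → K)
    (h0 : coord g 0 = ψ z) (hs : ∀ j, coord g j.succ = ψ (x j)) (s' : Fin (N + 1) →₀ ℕ) (c : ℂ) :
    evalAt (monomial s' c) g = c * ψ (z ^ (s' 0) * ∏ j : Fin N, x j ^ (s' j.succ)) := by
  rw [evalAt, eval_monomial, Finsupp.prod_fintype _ _ (fun i => by rw [pow_zero]),
    Fin.prod_univ_succ, h0]
  simp only [hs, map_mul, map_pow, map_prod]

/-- **The value of a word at a point of the box** (one monomial). With the data of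
`exists_coeffs_wordDeriv_monomial` and a point `z = ∑ᵢ hᵢ aᵢ`, `xⱼ = ∏ᵢ θᵢⱼ^{hᵢ}` (`0 ≤ hᵢ ≤ S'`,
`θᵢⱼ ≠ 0`): there is `v ∈ K` with `(D_{ψε₀}⋯D_{ψε_{j-1}} X^s)(ψ-point) = ψ(v)` for every `ψ`,
`b^{j + s₀ + #ι S' |s'|} v ∈ 𝓞_K` (`|s'| = ∑ₕ s_{h+1}`) when `b aᵢ, b θᵢⱼ, b εₗ` are integral, and
`|ψ(v)| ≤ (s₀+1) ((s₀+|s'|)E)^j (#ι S' A + 1)^{s₀} Θ^{#ι S' |s'|}` when `|ψ(εₗ)| ≤ E`, `|ψ(aᵢ)| ≤ A`,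
`|ψ(θᵢⱼ)| ≤ Θ` (`Θ ≥ 1`). [folklore] -/
theorem exists_wordValue_monomial (a : ι → K) (θ : ι → Fin N → K) (hθ : ∀ i j, θ i j ≠ 0)
    (h : ι → ℕ) {S' : ℕ} (hh : ∀ i, h i ≤ S') (s : Fin (N + 1) →₀ ℕ) {j : ℕ}
    (ε : Fin j → K × (Fin N → K)) :
    ∃ v : K,
      (∀ ψ : K →+* ℂ,
        evalAt (wordDeriv (fun l => ((ψ (ε l).1, fun h' => ψ ((ε l).2 h')) : ℂ × (Fin N → ℂ)))
            (monomial s (1 : ℂ)))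
          ((Multiplicative.ofAdd (ψ (∑ i, (h i : K) * a i)), fun j' =>
              Units.mk0 (ψ (∏ i, θ i j' ^ h i))
                ((map_ne_zero ψ).mpr (Finset.prod_ne_zero_iff.mpr fun i _ => pow_ne_zero _ (hθ i j')))) :
            GaGm N) = ψ v) ∧
      (∀ b : ℕ, (∀ i, IsIntegral ℤ ((b : K) * a i)) → (∀ i j', IsIntegral ℤ ((b : K) * θ i j')) →
        (∀ l, IsIntegral ℤ ((b : K) * (ε l).1) ∧ ∀ h', IsIntegral ℤ ((b : K) * (ε l).2 h')) →
        IsIntegral ℤ ((b : K) ^ (j + s 0 + Fintype.card ι * S' * ∑ h' : Fin N, s h'.succ) * v)) ∧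
      (∀ (ψ : K →+* ℂ) (E A Θ : ℝ), 0 ≤ A → 1 ≤ Θ →
        (∀ l, ‖ψ (ε l).1‖ ≤ E ∧ ∀ h', ‖ψ ((ε l).2 h')‖ ≤ E) → (∀ i, ‖ψ (a i)‖ ≤ A) →
        (∀ i j', ‖ψ (θ i j')‖ ≤ Θ) →
        ‖ψ v‖ ≤ ((s 0 : ℝ) + 1) * ((((s 0 : ℝ) + ∑ h' : Fin N, (s h'.succ : ℝ)) * E) ^ j *
          ((Fintype.card ι * S' * A + 1) ^ (s 0) * Θ ^ (Fintype.card ι * S' * ∑ h' : Fin N, s h'.succ)))) := by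
  obtain ⟨c, hc0, hcP, hcI, hcB⟩ := exists_coeffs_wordDeriv_monomial (K := K) s ε
  set z : K := ∑ i, (h i : K) * a i with hz
  set x : Fin N → K := fun j' => ∏ i, θ i j' ^ h i with hx
  refine ⟨∑ i ∈ range (s 0 + 1), c i * (z ^ i * ∏ j' : Fin N, x j' ^ (s j'.succ)), fun ψ => ?_,
    fun b ha hθb hε => ?_, fun ψ E A Θ hA hΘ hE haA hθΘ => ?_⟩
  · -- the bridge to the complex computation
    rw [hcP ψ, evalAt, map_sum (MvPolynomial.eval (R := ℂ) (σ := Fin (N + 1)) _),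
      map_sum ψ _ (range (s 0 + 1))]
    refine Finset.sum_congr rfl fun i _ => ?_
    have := evalAt_monomial_of_coord ψ
      ((Multiplicative.ofAdd (ψ (∑ i, (h i : K) * a i)), fun j' =>
          Units.mk0 (ψ (∏ i, θ i j' ^ h i))
            ((map_ne_zero ψ).mpr (Finset.prod_ne_zero_iff.mpr fun i _ => pow_ne_zero _ (hθ i j')))) :
        GaGm N) z x (by rw [coord_zero, toAdd_ofAdd]) (fun j' => by rw [coord_succ, Units.val_mk0])
      (s.update 0 i) (ψ (c i))
    simp only [update_zero_apply_zero, update_zero_apply_succ] at this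
    rw [evalAt] at this
    rw [this, ← map_mul]
  · -- integrality
    rw [Finset.mul_sum]
    refine IsIntegral.sum _ fun i hi => ?_
    have hi' : i ≤ s 0 := Nat.lt_succ_iff.mp (Finset.mem_range.mp hi)
    have h1 : IsIntegral ℤ ((b : K) ^ j * c i) := hcI b hε i
    have hzint : IsIntegral ℤ ((b : K) * z) := by
      rw [hz, Finset.mul_sum]
      refine IsIntegral.sum _ fun i' _ => ?_
      rw [mul_left_comm]
      exact (isIntegral_natCast _).mul (ha i')
    have h2 : IsIntegral ℤ ((b : K) ^ (s 0) * z ^ i) :=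
      isIntegral_pow_mul_of_le (isIntegral_pow_mul_pow hzint i) hi'
    have h3a : ∀ j' : Fin N, IsIntegral ℤ ((b : K) ^ (Fintype.card ι * S' * s j'.succ) *
        x j' ^ (s j'.succ)) := by
      intro j'
      have h3b : IsIntegral ℤ ((b : K) ^ (∑ i' : ι, h i' * s j'.succ) *
          ∏ i' : ι, (θ i' j' ^ h i') ^ s j'.succ) :=
        isIntegral_pow_sum_mul_prod _ _ _ fun i' _ => by
          rw [← pow_mul]
          exact isIntegral_pow_mul_pow (hθb i' j') _
      rw [Finset.prod_pow] at h3b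
      refine isIntegral_pow_mul_of_le h3b ?_
      calc ∑ i' : ι, h i' * s j'.succ ≤ ∑ _i' : ι, S' * s j'.succ :=
            Finset.sum_le_sum fun i' _ => Nat.mul_le_mul_right _ (hh i')
        _ = Fintype.card ι * S' * s j'.succ := by
            rw [Finset.sum_const, Finset.card_univ, smul_eq_mul, mul_assoc]
    have h3 : IsIntegral ℤ ((b : K) ^ (Fintype.card ι * S' * ∑ h' : Fin N, s h'.succ) *
        ∏ j' : Fin N, x j' ^ (s j'.succ)) := by
      have := isIntegral_pow_sum_mul_prod (Finset.univ : Finset (Fin N)) _ _ fun j' _ => h3a j'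
      rwa [← Finset.mul_sum] at this
    have hprod : (b : K) ^ (j + s 0 + Fintype.card ι * S' * ∑ h' : Fin N, s h'.succ) *
        (c i * (z ^ i * ∏ j' : Fin N, x j' ^ (s j'.succ))) =
        ((b : K) ^ j * c i) * (((b : K) ^ (s 0) * z ^ i) *
          ((b : K) ^ (Fintype.card ι * S' * ∑ h' : Fin N, s h'.succ) *
            ∏ j' : Fin N, x j' ^ (s j'.succ))) := by
      ring
    rw [hprod]
    exact h1.mul (h2.mul h3)
  · -- bounds
    have hB := hcB ψ E hE
    set X : ℝ := (((s 0 : ℝ) + ∑ h' : Fin N, (s h'.succ : ℝ)) * E) ^ j with hX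
    have hX0 : 0 ≤ X := (norm_nonneg _).trans (hB 0)
    set Z : ℝ := Fintype.card ι * S' * A + 1 with hZ
    have hZ1 : 1 ≤ Z := by rw [hZ]; nlinarith [show (0:ℝ) ≤ Fintype.card ι * S' * A by positivity]
    have hzle : ‖ψ z‖ ≤ Z := by
      rw [hz, map_sum]
      refine (norm_sum_le _ _).trans ?_
      calc ∑ i, ‖ψ ((h i : K) * a i)‖ ≤ ∑ _i : ι, (S' : ℝ) * A := Finset.sum_le_sum fun i _ => by
              rw [map_mul, map_natCast, norm_mul, Complex.norm_natCast]
              exact mul_le_mul (by exact_mod_cast hh i) (haA i) (norm_nonneg _) (Nat.cast_nonneg _)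
        _ = Fintype.card ι * S' * A := by
            rw [Finset.sum_const, Finset.card_univ, nsmul_eq_mul, mul_assoc]
        _ ≤ Z := by rw [hZ]; linarith
    have hxle : ∀ j', ‖ψ (x j')‖ ≤ Θ ^ (Fintype.card ι * S') := fun j' => by
      simp only [hx, map_prod, map_pow, norm_prod, norm_pow]
      calc ∏ i, ‖ψ (θ i j')‖ ^ h i ≤ ∏ _i : ι, Θ ^ S' := Finset.prod_le_prod (fun _ _ => by positivity)
              fun i _ => (pow_le_pow_left₀ (norm_nonneg _) (hθΘ i j') _).trans
                (pow_le_pow_right₀ hΘ (hh i))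
        _ = Θ ^ (Fintype.card ι * S') := by
            rw [Finset.prod_const, Finset.card_univ, ← pow_mul, mul_comm]
    have hXle : ‖ψ (∏ j' : Fin N, x j' ^ (s j'.succ))‖ ≤
        Θ ^ (Fintype.card ι * S' * ∑ h' : Fin N, s h'.succ) := by
      simp only [map_prod, map_pow, norm_prod, norm_pow]
      calc ∏ j', ‖ψ (x j')‖ ^ s j'.succ ≤ ∏ j' : Fin N, (Θ ^ (Fintype.card ι * S')) ^ s j'.succ :=
            Finset.prod_le_prod (fun _ _ => by positivity) fun j' _ =>
              pow_le_pow_left₀ (norm_nonneg _) (hxle j') _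
        _ = Θ ^ (Fintype.card ι * S' * ∑ h' : Fin N, s h'.succ) := by
            rw [Finset.prod_pow_eq_pow_sum, ← pow_mul]
    rw [map_sum]
    refine (norm_sum_le _ _).trans ?_
    calc ∑ i ∈ range (s 0 + 1), ‖ψ (c i * (z ^ i * ∏ j' : Fin N, x j' ^ (s j'.succ)))‖
        ≤ ∑ _i ∈ range (s 0 + 1), X * (Z ^ (s 0) * Θ ^ (Fintype.card ι * S' * ∑ h' : Fin N, s h'.succ)) := by
          refine Finset.sum_le_sum fun i hi => ?_
          have hi' : i ≤ s 0 := Nat.lt_succ_iff.mp (Finset.mem_range.mp hi)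
          rw [map_mul, map_mul, map_pow, norm_mul, norm_mul, norm_pow]
          refine mul_le_mul (hB i) (mul_le_mul ?_ hXle (norm_nonneg _) (by positivity))
            (by positivity) hX0
          exact (pow_le_pow_left₀ (norm_nonneg _) hzle _).trans (pow_le_pow_right₀ hZ1 hi')
      _ = ((s 0 : ℝ) + 1) * (X * (Z ^ (s 0) * Θ ^ (Fintype.card ι * S' * ∑ h' : Fin N, s h'.succ))) := by
          rw [Finset.sum_const, Finset.card_range, nsmul_eq_mul]
          push_cast
          ring

/-- **The value of a word at a point of the box** for `P = ∑_λ a_λ X^{s_λ}` with integer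
coefficients `|a_λ| ≤ H`, `deg_{X₀} < D₀`, total torus degree `≤ D₁`: it is `ψ(v)` with `v ∈ K`
independent of the embedding `ψ`, `b^{j + D₀ + #ι S' D₁} v ∈ 𝓞_K`, and
`|ψ(v)| ≤ #Λ H D₀ ((D₀ + D₁)E)^j (#ι S' A + 1)^{D₀} Θ^{#ι S' D₁}` for every `ψ`. [folklore] -/
theorem exists_wordValue {Λ : Type*} [Fintype Λ] (a : ι → K) (θ : ι → Fin N → K)
    (hθ : ∀ i j, θ i j ≠ 0) (h : ι → ℕ) {S' : ℕ} (hh : ∀ i, h i ≤ S') {D₀ D₁ : ℕ}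
    (sx : Λ → Fin (N + 1) →₀ ℕ) (hs0 : ∀ l, sx l 0 < D₀) (hs1 : ∀ l, ∑ h' : Fin N, sx l h'.succ ≤ D₁)
    (coef : Λ → ℤ) {H : ℕ} (hcoef : ∀ l, |coef l| ≤ H) {j : ℕ} (ε : Fin j → K × (Fin N → K)) :
    ∃ v : K,
      (∀ ψ : K →+* ℂ,
        evalAt (wordDeriv (fun l => ((ψ (ε l).1, fun h' => ψ ((ε l).2 h')) : ℂ × (Fin N → ℂ)))
            (∑ l, monomial (sx l) ((coef l : ℤ) : ℂ)))
          ((Multiplicative.ofAdd (ψ (∑ i, (h i : K) * a i)), fun j' =>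
              Units.mk0 (ψ (∏ i, θ i j' ^ h i))
                ((map_ne_zero ψ).mpr (Finset.prod_ne_zero_iff.mpr fun i _ => pow_ne_zero _ (hθ i j')))) :
            GaGm N) = ψ v) ∧
      (∀ b : ℕ, (∀ i, IsIntegral ℤ ((b : K) * a i)) → (∀ i j', IsIntegral ℤ ((b : K) * θ i j')) →
        (∀ l, IsIntegral ℤ ((b : K) * (ε l).1) ∧ ∀ h', IsIntegral ℤ ((b : K) * (ε l).2 h')) →
        IsIntegral ℤ ((b : K) ^ (j + D₀ + Fintype.card ι * S' * D₁) * v)) ∧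
      (∀ (ψ : K →+* ℂ) (E A Θ : ℝ), 0 ≤ E → 0 ≤ A → 1 ≤ Θ →
        (∀ l, ‖ψ (ε l).1‖ ≤ E ∧ ∀ h', ‖ψ ((ε l).2 h')‖ ≤ E) → (∀ i, ‖ψ (a i)‖ ≤ A) →
        (∀ i j', ‖ψ (θ i j')‖ ≤ Θ) →
        ‖ψ v‖ ≤ Fintype.card Λ * H * (D₀ * ((((D₀ : ℝ) + D₁) * E) ^ j *
          ((Fintype.card ι * S' * A + 1) ^ D₀ * Θ ^ (Fintype.card ι * S' * D₁))))) := by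
  classical
  have hmono := fun l => exists_wordValue_monomial a θ hθ h hh (sx l) ε
  choose v hvP hvI hvB using hmono
  refine ⟨∑ l, (coef l : K) * v l, fun ψ => ?_, fun b ha hθb hε => ?_,
    fun ψ E A Θ hE0 hA hΘ hE haA hθΘ => ?_⟩
  · -- bridge
    rw [wordDeriv_sum, evalAt, map_sum (MvPolynomial.eval (R := ℂ) (σ := Fin (N + 1)) _),
      map_sum ψ (fun l => (coef l : K) * v l) Finset.univ]
    refine Finset.sum_congr rfl fun l _ => ?_
    have hsm : (monomial (sx l)) (((coef l : ℤ) : ℂ)) = (((coef l : ℤ) : ℂ)) • monomial (sx l) (1 : ℂ) := by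
      rw [smul_monomial, smul_eq_mul, mul_one]
    rw [hsm, wordDeriv_smul, MvPolynomial.smul_eval, ← evalAt, hvP l ψ, map_mul, map_intCast]
  · -- integrality
    rw [Finset.mul_sum]
    refine IsIntegral.sum _ fun l _ => ?_
    have h1 := hvI l b ha hθb hε
    have h2 : IsIntegral ℤ ((b : K) ^ (j + D₀ + Fintype.card ι * S' * D₁) * v l) := by
      refine isIntegral_pow_mul_of_le h1 ?_
      have := hs0 l
      have := Nat.mul_le_mul_left (Fintype.card ι * S') (hs1 l)
      omega
    have h3 : IsIntegral ℤ ((coef l : ℤ) : K) := by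
      have := isIntegral_algebraMap (R := ℤ) (A := K) (x := coef l)
      rwa [eq_intCast] at this
    rw [mul_left_comm]
    exact h3.mul h2
  · -- bounds
    rw [map_sum]
    refine (norm_sum_le _ _).trans ?_
    have hX : ∀ l, (((sx l 0 : ℝ) + ∑ h' : Fin N, (sx l h'.succ : ℝ)) * E) ^ j ≤
        (((D₀ : ℝ) + D₁) * E) ^ j := fun l => by
      refine pow_le_pow_left₀ (by positivity) (mul_le_mul_of_nonneg_right ?_ hE0) _
      have h1 : ((sx l 0 : ℕ) : ℝ) ≤ D₀ := by exact_mod_cast (hs0 l).le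
      have h2 : (∑ h' : Fin N, (sx l h'.succ : ℝ)) ≤ D₁ := by exact_mod_cast hs1 l
      linarith
    set Z : ℝ := Fintype.card ι * S' * A + 1 with hZ
    have hZ1 : 1 ≤ Z := by rw [hZ]; nlinarith [show (0:ℝ) ≤ Fintype.card ι * S' * A by positivity]
    calc ∑ l, ‖ψ ((coef l : K) * v l)‖
        ≤ ∑ _l : Λ, (H : ℝ) * (D₀ * ((((D₀ : ℝ) + D₁) * E) ^ j *
            (Z ^ D₀ * Θ ^ (Fintype.card ι * S' * D₁)))) := by
          refine Finset.sum_le_sum fun l _ => ?_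
          rw [map_mul, map_intCast, norm_mul, Complex.norm_intCast]
          refine mul_le_mul (by exact_mod_cast hcoef l) ?_ (norm_nonneg _) (Nat.cast_nonneg _)
          refine (hvB l ψ E A Θ hA hΘ hE haA hθΘ).trans ?_
          have h1 : ((sx l 0 : ℕ) : ℝ) + 1 ≤ D₀ := by exact_mod_cast hs0 l
          have hXl := hX l
          have hX0 : 0 ≤ (((sx l 0 : ℝ) + ∑ h' : Fin N, (sx l h'.succ : ℝ)) * E) ^ j := by positivity
          have h3 : Z ^ (sx l 0) ≤ Z ^ D₀ := pow_le_pow_right₀ hZ1 (hs0 l).le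
          have h4 : Θ ^ (Fintype.card ι * S' * ∑ h' : Fin N, sx l h'.succ) ≤
              Θ ^ (Fintype.card ι * S' * D₁) :=
            pow_le_pow_right₀ hΘ (Nat.mul_le_mul_left _ (hs1 l))
          gcongr
      _ = Fintype.card Λ * H * (D₀ * ((((D₀ : ℝ) + D₁) * E) ^ j *
            (Z ^ D₀ * Θ ^ (Fintype.card ι * S' * D₁)))) := by
          rw [Finset.sum_const, Finset.card_univ, nsmul_eq_mul]; ring

/-- **Liouville: a small value of a word is zero.** In the situation of `exists_wordValue`, with
`K` a number field of degree `d`, `b ≥ 1` a common denominator of the `aᵢ, θᵢⱼ, εₗ`, and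
`M = max(1, #Λ H D₀ ((D₀+D₁)E)^j (#ι S' A + 1)^{D₀} Θ^{#ι S' D₁})` (a bound for all the conjugates):
if the complex value `(D_{σε₀}⋯D_{σε_{j-1}} P)(σ-point)` has modulus
`< (b^{(j + D₀ + #ι S' D₁) d} M^{d-1})⁻¹` then it vanishes
(`Baker1975.Ch3.liouville_lower_bound`). [cite: Waldschmidt1988, §6 (Liouville's inequality, p. 389)] -/
theorem wordValue_eq_zero_of_small [NumberField K] {Λ : Type*} [Fintype Λ] (σ : K →+* ℂ)
    (a : ι → K) (θ : ι → Fin N → K) (hθ : ∀ i j, θ i j ≠ 0) (h : ι → ℕ) {S' : ℕ}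
    (hh : ∀ i, h i ≤ S') {D₀ D₁ : ℕ} (sx : Λ → Fin (N + 1) →₀ ℕ) (hs0 : ∀ l, sx l 0 < D₀)
    (hs1 : ∀ l, ∑ h' : Fin N, sx l h'.succ ≤ D₁) (coef : Λ → ℤ) {H : ℕ} (hcoef : ∀ l, |coef l| ≤ H)
    {j : ℕ} (ε : Fin j → K × (Fin N → K)) {b : ℕ} (hb : 1 ≤ b)
    (ha : ∀ i, IsIntegral ℤ ((b : K) * a i)) (hθb : ∀ i j', IsIntegral ℤ ((b : K) * θ i j'))
    (hε : ∀ l, IsIntegral ℤ ((b : K) * (ε l).1) ∧ ∀ h', IsIntegral ℤ ((b : K) * (ε l).2 h'))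
    {E A Θ : ℝ} (hE0 : 0 ≤ E) (hA : 0 ≤ A) (hΘ : 1 ≤ Θ)
    (hEψ : ∀ (ψ : K →+* ℂ) l, ‖ψ (ε l).1‖ ≤ E ∧ ∀ h', ‖ψ ((ε l).2 h')‖ ≤ E)
    (hAψ : ∀ (ψ : K →+* ℂ) i, ‖ψ (a i)‖ ≤ A) (hΘψ : ∀ (ψ : K →+* ℂ) i j', ‖ψ (θ i j')‖ ≤ Θ)
    (hsmall : ‖evalAt (wordDeriv (fun l => ((σ (ε l).1, fun h' => σ ((ε l).2 h')) : ℂ × (Fin N → ℂ)))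
            (∑ l, monomial (sx l) ((coef l : ℤ) : ℂ)))
          ((Multiplicative.ofAdd (σ (∑ i, (h i : K) * a i)), fun j' =>
              Units.mk0 (σ (∏ i, θ i j' ^ h i))
                ((map_ne_zero σ).mpr (Finset.prod_ne_zero_iff.mpr fun i _ => pow_ne_zero _ (hθ i j')))) :
            GaGm N)‖ <
        (((b : ℝ) ^ (j + D₀ + Fintype.card ι * S' * D₁)) ^ Module.finrank ℚ K *
          (max 1 (Fintype.card Λ * H * (D₀ * ((((D₀ : ℝ) + D₁) * E) ^ j *
            ((Fintype.card ι * S' * A + 1) ^ D₀ * Θ ^ (Fintype.card ι * S' * D₁)))))) ^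
              (Module.finrank ℚ K - 1))⁻¹) :
    evalAt (wordDeriv (fun l => ((σ (ε l).1, fun h' => σ ((ε l).2 h')) : ℂ × (Fin N → ℂ)))
        (∑ l, monomial (sx l) ((coef l : ℤ) : ℂ)))
      ((Multiplicative.ofAdd (σ (∑ i, (h i : K) * a i)), fun j' =>
          Units.mk0 (σ (∏ i, θ i j' ^ h i))
            ((map_ne_zero σ).mpr (Finset.prod_ne_zero_iff.mpr fun i _ => pow_ne_zero _ (hθ i j')))) :
        GaGm N) = 0 := by
  obtain ⟨v, hvP, hvI, hvB⟩ := exists_wordValue a θ hθ h hh sx hs0 hs1 coef hcoef ε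
  rw [hvP σ] at hsmall ⊢
  by_contra hne
  have hv0 : v ≠ 0 := fun h0 => hne (by rw [h0, map_zero])
  set M₀ : ℝ := Fintype.card Λ * H * (D₀ * ((((D₀ : ℝ) + D₁) * E) ^ j *
    ((Fintype.card ι * S' * A + 1) ^ D₀ * Θ ^ (Fintype.card ι * S' * D₁)))) with hM₀
  have hM1 : (1 : ℝ) ≤ max 1 M₀ := le_max_left _ _
  have hM : ∀ φ : K →+* ℂ, ‖φ v‖ ≤ max 1 M₀ := fun φ =>
    (hvB φ E A Θ hE0 hA hΘ (hEψ φ) (hAψ φ) (hΘψ φ)).trans (le_max_right _ _)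
  have hint : IsIntegral ℤ ((((b ^ (j + D₀ + Fintype.card ι * S' * D₁) : ℕ) : K)) * v) := by
    rw [Nat.cast_pow]
    exact hvI b ha hθb hε
  have hb' : 1 ≤ b ^ (j + D₀ + Fintype.card ι * S' * D₁) := Nat.one_le_pow _ _ hb
  have key := Baker1975.Ch3.liouville_lower_bound σ hv0 hb' hint hM1 hM
  rw [Nat.cast_pow] at key
  exact absurd (lt_of_lt_of_le hsmall key) (lt_irrefl _)

end Values

end Literature.NumberTheory.Transcendental.LinearSubgroupGaGm

end
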